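import Literature.NumberTheory.Sieve.HeathBrownCubicWCalculus
import Literature.NumberTheory.Sieve.HeathBrownCubicHatCore
import HarnessLib

/-!
# The trivial bounds `d_S ≪ 1`, `e_S ≪ τ(S)`, `f_S ≪ τ(S)` for Heath-Brown's Type II weights

Pure-proof file (no definitions, no named facts) in the decomposition of **Heath-Brown's Type II
estimate, Lemma 3.10** (`HeathBrown2001_lemma_3_10` of `HeathBrownCubicTypeII`), D. R. Heath-Brown,
*Primes represented by `x³ + 2y³`*, Acta Math. 186 (2001), 1–84.  The proof of Lemma 3.10 (§§11–13)
uses repeatedly the "trivial bound" for the weights of (3.11)–(3.12): "From (3.12) and (8.4) we see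
that `e_S ≪ τ(S) log X`, whence `f_S ≪ τ(S) log X`, by (3.11) and (9.22)" (p. 67; again on p. 68,
"Since `F_β ≪ τ(β) log X`", and on p. 82, "we use the trivial bound `f_(β) ≪ τ(β) log X`").  Here
(9.22) is `d_S ≪ 1`.  This file PROVES these bounds for the tree's `dWeight`, `eWeight`, `fWeight`
(in fact without the factor `log X`, which the printed argument can afford to lose): for `X > 1`,
`0 < τ ≤ 1` and every vector `𝐦` satisfying (3.5)–(3.7) (`CoreAdmissible`),

* `card_filter_prod_eq_le_one` — at most one prime tuple `(P_i) ∈ ∏ 𝒥(m_i)` has `∏ P_i = S`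
  ("the ideals `S` are square-free", (3.5); `tuple_eq_of_prod_eq` of `HeathBrownCubicHatCore`);
* `dWeight_nonneg`, `dWeight_le_eight` — `0 ≤ d_S ≤ (1 + τ⁴)^{n+1} ≤ e^{3/2} ≤ 8`, since
  `m_i ≥ τξ⁻¹ = τ⁻⁴` and `(n + 1)τ < 3/2` ((9.22): "`d_S ≪ 1`");
* `abs_eWeight_le` — `|e_S| ≤ τ_K(S)/2`: by (8.4) (`wDeriv_le` of `HeathBrownCubicWCalculus`,
  `0 ≤ w'(t) ≤ (ξ log X)^n`), `∏ (m_i ξ log X) = M (ξ log X)^{n+1}` with `M ≥ τ⁻⁴`, `|μ(J)| ≤ 1` and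
  `0 ≤ log(L/N(J)) ≤ log L = (τ/2) log X` for the divisors `J ∣ S` with `N(J) < L`;
* **`abs_fWeight_le`** — `|f_S| ≤ 9 τ_K(S)` (`f = d − e`, (3.11)), `τ_K = idealDivisorCount`.

## References

* D. R. Heath-Brown, *Primes represented by `x³ + 2y³`*, Acta Math. 186 (2001), 1–84: (3.11)–(3.13)
  p. 18, (8.4) p. 48, (9.22), p. 67. [cite: HeathBrownActa2001, §11 p. 67]

## Mathlib / tree search

Tree: `HeathBrownCubicTypeII` (`dWeight`, `eWeight`, `fWeight`, `idealMoebius`, `idealDivisors`,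
`CoreAdmissible`, `card_mul_lt_of_coreAdmissible`, `hbXi`, `hbL`), `HeathBrownCubicHatCore`
(`tuple_eq_of_prod_eq`, `tupleWt_bounds`), `HeathBrownCubicWCalculus` (`wDeriv_nonneg`, `wDeriv_le`),
`HeathBrownCubicSieveSetup` (`idealDivisorCount`). Mathlib: `Real.add_one_le_exp`, `Real.exp_one_lt_d9`,
`Finset.sum_le_card_nsmul`, `Fin.prod_univ_succ`.
-/

noncomputable section

open Polynomial NumberField Finset Filter Topology

namespace Literature.NumberTheory.Sieve.CubicSieve

open LFunctions.CubeRootTwoField CubicPrimes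

variable {X τ : ℝ}

/-! ### `d_S`: at most one tuple, `0 ≤ d_S ≤ 8` -/

/-- At most one prime tuple `(P_i) ∈ ∏_i 𝒥(m_i)` with `𝐦` strictly decreasing has a given product
("the intervals `J(m_i)` are disjoint, and the ideals `S` are square-free", (3.5)).
[cite: HeathBrownActa2001, §3 (3.5)] -/
theorem card_filter_prod_eq_le_one (hX : 1 < X) (hτ : 0 < τ) {k : ℕ} {m : Fin k → ℕ}
    (hm : StrictAnti m) (S : Ideal (𝓞 K)) :
    #((Fintype.piFinset fun i => Jprimes X τ (m i)).filter (fun P => ∏ i, P i = S)) ≤ 1 := by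
  classical
  rw [Finset.card_le_one]
  intro P hP P' hP'
  rw [mem_filter] at hP hP'
  exact (tuple_eq_of_prod_eq hX hτ hm hm hP.1 hP'.1 (hP.2.trans hP'.2.symm)).1

/-- The integer `μ = ⌈τ⁻⁴⌉` bounds the entries of an admissible vector from below: `m_i ≥ τξ⁻¹ = τ⁻⁴`
((3.5)), and `μ ≥ 1`, `μ⁻¹ ≤ τ⁴` for `0 < τ ≤ 1`. [cite: HeathBrownActa2001, §3 (3.5)] -/
theorem ceil_le_of_coreAdmissible (hτ : 0 < τ) (hτ1 : τ ≤ 1) {k : ℕ} {m : Fin k → ℕ}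
    (hm : CoreAdmissible τ m) :
    1 ≤ ⌈(τ ^ 4)⁻¹⌉₊ ∧ (1 : ℝ) / ⌈(τ ^ 4)⁻¹⌉₊ ≤ τ ^ 4 ∧ ∀ i, ⌈(τ ^ 4)⁻¹⌉₊ ≤ m i := by
  have hτ4 : 0 < τ ^ 4 := by positivity
  have hτ41 : τ ^ 4 ≤ 1 := pow_le_one₀ hτ.le hτ1
  have hinv : 1 ≤ (τ ^ 4)⁻¹ := one_le_inv_iff₀.mpr ⟨hτ4, hτ41⟩
  have hceil : (τ ^ 4)⁻¹ ≤ ⌈(τ ^ 4)⁻¹⌉₊ := Nat.le_ceil _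
  refine ⟨?_, ?_, fun i => ?_⟩
  · have : (1 : ℝ) ≤ ⌈(τ ^ 4)⁻¹⌉₊ := hinv.trans hceil
    exact_mod_cast this
  · rw [div_le_iff₀ (lt_of_lt_of_le (by positivity) hceil), ← div_le_iff₀' hτ4, one_div]
    exact hceil
  · have h5 := hm.2.1 i
    rw [hbXi, show τ / τ ^ 5 = (τ ^ 4)⁻¹ by field_simp] at h5
    exact Nat.ceil_le.mpr h5

/-- `d_S ≥ 0`. [cite: HeathBrownActa2001, §3 p. 15] -/
theorem dWeight_nonneg (hX : 1 < X) (hτ : 0 < τ) (hτ1 : τ ≤ 1) {k : ℕ} {m : Fin k → ℕ}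
    (hm : CoreAdmissible τ m) (S : Ideal (𝓞 K)) : 0 ≤ dWeight X τ m S := by
  classical
  obtain ⟨hμ1, -, hμm⟩ := ceil_le_of_coreAdmissible hτ hτ1 hm
  unfold dWeight
  refine sum_nonneg fun P hP => ?_
  rw [mem_filter] at hP
  exact zero_le_one.trans (tupleWt_bounds hX hτ hμ1 hμm hP.1).1

/-- **(9.22), `d_S ≪ 1`**: `d_S ≤ 8` for `X > 1`, `0 < τ ≤ 1` and `𝐦` satisfying (3.5)–(3.7): at most one
tuple contributes, with weight `≤ (1 + μ⁻¹)^{n+1} ≤ exp((n+1)τ⁴) ≤ e^{3/2}` (`(n+1)τ < 3/2`).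
[cite: HeathBrownActa2001, §9 (9.22)] -/
theorem dWeight_le_eight (hX : 1 < X) (hτ : 0 < τ) (hτ1 : τ ≤ 1) {k : ℕ} {m : Fin k → ℕ}
    (hm : CoreAdmissible τ m) (S : Ideal (𝓞 K)) : dWeight X τ m S ≤ 8 := by
  classical
  obtain ⟨hμ1, hμτ, hμm⟩ := ceil_le_of_coreAdmissible hτ hτ1 hm
  set μ : ℕ := ⌈(τ ^ 4)⁻¹⌉₊ with hμ
  have hkτ : (k : ℝ) * τ < 3 / 2 - τ := card_mul_lt_of_coreAdmissible hτ hm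
  -- the bound for one tuple
  have hbound : (1 + 1 / (μ : ℝ)) ^ k ≤ 8 := by
    have h1 : (1 + 1 / (μ : ℝ)) ^ k ≤ Real.exp ((k : ℝ) * τ ^ 4) := by
      calc (1 + 1 / (μ : ℝ)) ^ k ≤ (Real.exp (1 / (μ : ℝ))) ^ k := by
            refine pow_le_pow_left₀ (by positivity) ?_ k
            have := Real.add_one_le_exp (1 / (μ : ℝ)); linarith
        _ = Real.exp ((k : ℝ) * (1 / (μ : ℝ))) := by rw [← Real.exp_nat_mul]
        _ ≤ Real.exp ((k : ℝ) * τ ^ 4) := Real.exp_le_exp.mpr (by gcongr)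
    have h2 : (k : ℝ) * τ ^ 4 ≤ 2 := by
      have hτ3 : τ ^ 3 ≤ 1 := pow_le_one₀ hτ.le hτ1
      have : (k : ℝ) * τ ^ 4 = ((k : ℝ) * τ) * τ ^ 3 := by ring
      rw [this]
      have hk0 : 0 ≤ (k : ℝ) * τ := by positivity
      nlinarith
    have h3 : Real.exp 2 ≤ 8 := by
      have he := Real.exp_one_lt_d9
      have : Real.exp 2 = Real.exp 1 * Real.exp 1 := by rw [← Real.exp_add]; norm_num
      rw [this]; nlinarith [Real.exp_pos 1]
    exact h1.trans ((Real.exp_le_exp.mpr h2).trans h3)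
  unfold dWeight
  set F := (Fintype.piFinset fun i => Jprimes X τ (m i)).filter (fun P => ∏ i, P i = S) with hF
  have hcard : #F ≤ 1 := card_filter_prod_eq_le_one hX hτ hm.1 S
  calc ∑ P ∈ F, ∏ i, Real.log (Ideal.absNorm (P i)) / ((m i : ℝ) * hbXi τ * Real.log X)
      ≤ ∑ P ∈ F, (8 : ℝ) := by
        refine sum_le_sum fun P hP => ?_
        rw [hF, mem_filter] at hP
        exact (tupleWt_bounds hX hτ hμ1 hμm hP.1).2.trans hbound
    _ = #F * 8 := by rw [sum_const, nsmul_eq_mul]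
    _ ≤ 1 * 8 := by gcongr; exact_mod_cast hcard
    _ = 8 := one_mul _

/-! ### `e_S`: `|e_S| ≤ τ_K(S)/2` -/

/-- `|μ(J)| ≤ 1`. [cite: HeathBrownActa2001, §3 (3.12)] -/
theorem abs_idealMoebius_le (J : Ideal (𝓞 K)) : |idealMoebius J| ≤ 1 := by
  classical
  unfold idealMoebius
  split_ifs
  · simp
  · simp

/-- The divisor set `idealDivisors S` has `τ_K(S)` elements. [folklore] -/
theorem card_idealDivisors (S : Ideal (𝓞 K)) : #(idealDivisors S) = idealDivisorCount S := rfl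

/-- `∏_i (m_i ξ log X) = (∏_i m_i) (ξ log X)^k`. [folklore] -/
theorem prod_mul_hbXi_mul_log {k : ℕ} (m : Fin k → ℕ) :
    ∏ i, ((m i : ℝ) * hbXi τ * Real.log X) = (∏ i, (m i : ℝ)) * (hbXi τ * Real.log X) ^ k := by
  simp only [mul_assoc]
  rw [prod_mul_distrib, prod_const, card_univ, Fintype.card_fin]

/-- For an admissible vector of length `n + 1`, `M = ∏ m_i ≥ τ⁻⁴` (`m_1 ≥ τ⁻⁴`, all `m_i ≥ 1`).
[cite: HeathBrownActa2001, §3 (3.5)] -/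
theorem inv_pow_four_le_prod (hτ : 0 < τ) (hτ1 : τ ≤ 1) {n : ℕ} {m : Fin (n + 1) → ℕ}
    (hm : CoreAdmissible τ m) : (τ ^ 4)⁻¹ ≤ ∏ i, (m i : ℝ) := by
  obtain ⟨hμ1, -, hμm⟩ := ceil_le_of_coreAdmissible hτ hτ1 hm
  have h0 : (τ ^ 4)⁻¹ ≤ m 0 := by
    have h5 := hm.2.1 0
    rwa [hbXi, show τ / τ ^ 5 = (τ ^ 4)⁻¹ by field_simp] at h5
  have hge1 : ∀ i, (1 : ℝ) ≤ m i := fun i => by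
    have : 1 ≤ m i := hμ1.trans (hμm i)
    exact_mod_cast this
  rw [Fin.prod_univ_succ]
  calc (τ ^ 4)⁻¹ = (τ ^ 4)⁻¹ * 1 := (mul_one _).symm
    _ ≤ (m 0 : ℝ) * ∏ i : Fin n, (m i.succ : ℝ) := by
        refine mul_le_mul h0 ?_ zero_le_one (by positivity)
        calc (1 : ℝ) = ∏ _i : Fin n, (1 : ℝ) := by simp
          _ ≤ ∏ i : Fin n, (m i.succ : ℝ) := prod_le_prod (fun _ _ => zero_le_one) fun i _ => hge1 _

/-- **`e_S ≪ τ(S)`** (p. 67: "From (3.12) and (8.4) we see that `e_S ≪ τ(S) log X`"): for `X > 1`,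
`0 < τ ≤ 1` and `𝐦` of length `n + 1` satisfying (3.5)–(3.7), `|e_S(𝐦)| ≤ τ_K(S)/2`. Indeed
`0 ≤ w'(N(S)) ≤ (ξ log X)^n` ((8.4)), `∏(m_iξ log X) = M(ξ log X)^{n+1}` with `M ≥ τ⁻⁴`, and the Möbius
sum has at most `τ_K(S)` terms of modulus `≤ log L = (τ/2) log X`; so
`|e_S| ≤ τ_K(S) (τ/2)/(ξM) ≤ τ_K(S)/2` (`ξ = τ⁵`). [cite: HeathBrownActa2001, §11 p. 67] -/
theorem abs_eWeight_le (hX : 1 < X) (hτ : 0 < τ) (hτ1 : τ ≤ 1) {n : ℕ} {m : Fin (n + 1) → ℕ}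
    (hm : CoreAdmissible τ m) (S : Ideal (𝓞 K)) :
    |eWeight X τ m S| ≤ (idealDivisorCount S : ℝ) / 2 := by
  classical
  have hX0 : 0 < X := by linarith
  have hX1 : 1 ≤ X := hX.le
  have hlX : 0 < Real.log X := Real.log_pos hX
  have hξ : 0 < hbXi τ := hbXi_pos hτ
  have hξL : 0 < hbXi τ * Real.log X := mul_pos hξ hlX
  have hM : (τ ^ 4)⁻¹ ≤ ∏ i, (m i : ℝ) := inv_pow_four_le_prod hτ hτ1 hm
  have hτ4 : 0 < τ ^ 4 := by positivity
  have hMpos : 0 < ∏ i, (m i : ℝ) := lt_of_lt_of_le (by positivity) hM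
  have hL1 : 1 ≤ hbL X τ := by
    rw [hbL]; exact Real.one_le_rpow hX1 (by positivity)
  have hlogL : Real.log (hbL X τ) = τ / 2 * Real.log X := by
    rw [hbL, Real.log_rpow hX0]
  -- the Möbius sum
  set F := (idealDivisors S).filter (fun J => (Ideal.absNorm J : ℝ) < hbL X τ) with hF
  have hterm : ∀ J ∈ F, |idealMoebius J * Real.log (hbL X τ / Ideal.absNorm J)| ≤
      Real.log (hbL X τ) := by
    intro J hJ
    rw [hF, mem_filter] at hJ
    rw [abs_mul]
    have h1 := abs_idealMoebius_le J
    have h2 : |Real.log (hbL X τ / Ideal.absNorm J)| ≤ Real.log (hbL X τ) := by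
      rcases Nat.eq_zero_or_pos (Ideal.absNorm J) with h0 | hpos
      · rw [h0, Nat.cast_zero, div_zero, Real.log_zero, abs_zero]
        exact Real.log_nonneg hL1
      · have hN1 : (1 : ℝ) ≤ Ideal.absNorm J := by exact_mod_cast hpos
        have hN0 : (0 : ℝ) < Ideal.absNorm J := by linarith
        have hq1 : 1 ≤ hbL X τ / Ideal.absNorm J := by
          rw [le_div_iff₀ hN0, one_mul]; exact hJ.2.le
        rw [abs_of_nonneg (Real.log_nonneg hq1)]
        refine Real.log_le_log (by positivity) ?_
        exact div_le_self (by linarith) hN1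
    calc |idealMoebius J| * |Real.log (hbL X τ / Ideal.absNorm J)| ≤ 1 * Real.log (hbL X τ) :=
          mul_le_mul h1 h2 (abs_nonneg _) zero_le_one
      _ = Real.log (hbL X τ) := one_mul _
  have hsum : |∑ J ∈ F, idealMoebius J * Real.log (hbL X τ / Ideal.absNorm J)| ≤
      (idealDivisorCount S : ℝ) * Real.log (hbL X τ) := by
    calc |∑ J ∈ F, idealMoebius J * Real.log (hbL X τ / Ideal.absNorm J)|
        ≤ ∑ J ∈ F, |idealMoebius J * Real.log (hbL X τ / Ideal.absNorm J)| := abs_sum_le_sum_abs _ _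
      _ ≤ ∑ J ∈ F, Real.log (hbL X τ) := sum_le_sum hterm
      _ = #F * Real.log (hbL X τ) := by rw [sum_const, nsmul_eq_mul]
      _ ≤ (idealDivisorCount S : ℝ) * Real.log (hbL X τ) := by
          refine mul_le_mul_of_nonneg_right ?_ (Real.log_nonneg hL1)
          rw [← card_idealDivisors]
          exact_mod_cast card_le_card (filter_subset _ _)
  -- the factor `w'(N(S))/∏(m_i ξ log X)`
  have hw0 : 0 ≤ wDeriv X τ m (Ideal.absNorm S) := wDeriv_nonneg hX0 m _
  have hw1 : wDeriv X τ m (Ideal.absNorm S) ≤ (hbXi τ * Real.log X) ^ n := wDeriv_le hX1 hτ.le m _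
  have hden : ∏ i, ((m i : ℝ) * hbXi τ * Real.log X) =
      (∏ i, (m i : ℝ)) * (hbXi τ * Real.log X) ^ (n + 1) := prod_mul_hbXi_mul_log m
  have hdenpos : 0 < ∏ i, ((m i : ℝ) * hbXi τ * Real.log X) := by rw [hden]; positivity
  have hfac : |wDeriv X τ m (Ideal.absNorm S) / ∏ i, ((m i : ℝ) * hbXi τ * Real.log X)| ≤
      1 / ((∏ i, (m i : ℝ)) * (hbXi τ * Real.log X)) := by
    rw [abs_div, abs_of_nonneg hw0, abs_of_pos hdenpos, hden, div_le_div_iff₀ (by positivity)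
      (by positivity), one_mul, pow_succ]
    calc wDeriv X τ m (Ideal.absNorm S) * ((∏ i, (m i : ℝ)) * (hbXi τ * Real.log X))
        ≤ (hbXi τ * Real.log X) ^ n * ((∏ i, (m i : ℝ)) * (hbXi τ * Real.log X)) :=
          mul_le_mul_of_nonneg_right hw1 (by positivity)
      _ = (∏ i, (m i : ℝ)) * ((hbXi τ * Real.log X) ^ n * (hbXi τ * Real.log X)) := by ring
  -- combine
  rw [eWeight, abs_mul]
  calc |wDeriv X τ m (Ideal.absNorm S) / ∏ i, ((m i : ℝ) * hbXi τ * Real.log X)| *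
        |∑ J ∈ F, idealMoebius J * Real.log (hbL X τ / Ideal.absNorm J)|
      ≤ (1 / ((∏ i, (m i : ℝ)) * (hbXi τ * Real.log X))) *
          ((idealDivisorCount S : ℝ) * Real.log (hbL X τ)) :=
        mul_le_mul hfac hsum (abs_nonneg _) (by positivity)
    _ = (idealDivisorCount S : ℝ) / 2 * ((τ ^ 4)⁻¹ / ∏ i, (m i : ℝ)) := by
        rw [hlogL, hbXi]
        field_simp
    _ ≤ (idealDivisorCount S : ℝ) / 2 * 1 := by
        refine mul_le_mul_of_nonneg_left ?_ (by positivity)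
        rw [div_le_one hMpos]; exact hM
    _ = (idealDivisorCount S : ℝ) / 2 := mul_one _

/-! ### `f_S`: `|f_S| ≤ 9 τ_K(S)` -/

/-- `τ_K(S) ≥ 1` (`S ∣ S`), for every `S` including `S = 0` (the tree's
`one_le_idealDivisorCount` in `HeathBrownCubicTypeITools` assumes `S ≠ 0`; not imported here). [folklore] -/
theorem one_le_idealDivisorCount_all (S : Ideal (𝓞 K)) : 1 ≤ idealDivisorCount S := by
  classical
  rw [← card_idealDivisors, Nat.one_le_iff_ne_zero, Ne, Finset.card_eq_zero, ← Ne,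
    ← Finset.nonempty_iff_ne_empty]
  refine ⟨S, ?_⟩
  simp only [idealDivisors, mem_filter, mem_idealsLE]
  exact ⟨le_rfl, dvd_rfl⟩

/-- **The trivial bound `f_S ≪ τ(S)`** (p. 67: "`e_S ≪ τ(S) log X`, whence `f_S ≪ τ(S) log X`, by
(3.11) and (9.22)"): for `X > 1`, `0 < τ ≤ 1` and `𝐦` of length `n + 1` satisfying (3.5)–(3.7),
`|f_S(𝐦)| ≤ 9 τ_K(S)` (`f = d − e`, `0 ≤ d_S ≤ 8`, `|e_S| ≤ τ_K(S)/2`, `τ_K(S) ≥ 1`).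
[cite: HeathBrownActa2001, §11 p. 67] -/
theorem abs_fWeight_le (hX : 1 < X) (hτ : 0 < τ) (hτ1 : τ ≤ 1) {n : ℕ} {m : Fin (n + 1) → ℕ}
    (hm : CoreAdmissible τ m) (S : Ideal (𝓞 K)) :
    |fWeight X τ m S| ≤ 9 * (idealDivisorCount S : ℝ) := by
  have hd0 := dWeight_nonneg hX hτ hτ1 hm S
  have hd8 := dWeight_le_eight hX hτ hτ1 hm S
  have he := abs_eWeight_le hX hτ hτ1 hm S
  have h1 : (1 : ℝ) ≤ idealDivisorCount S := by exact_mod_cast one_le_idealDivisorCount_all S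
  rw [fWeight]
  calc |dWeight X τ m S - eWeight X τ m S| ≤ |dWeight X τ m S| + |eWeight X τ m S| := abs_sub _ _
    _ ≤ 8 + (idealDivisorCount S : ℝ) / 2 := by rw [abs_of_nonneg hd0]; exact add_le_add hd8 he
    _ ≤ 9 * (idealDivisorCount S : ℝ) := by linarith

end Literature.NumberTheory.Sieve.CubicSieve

end
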